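import Summits.BirchSwinnertonDyer.BirchSwinnertonDyer.Theorems.CyclotomicUntwistGNineNineGoodModelOfPSRow
import Summits.BirchSwinnertonDyer.BirchSwinnertonDyer.Theorems.CyclotomicUntwistNineIntegersResidueMap
import Summits.BirchSwinnertonDyer.BirchSwinnertonDyer.Theses.CyclotomicUntwist
import HarnessLib

/-!
# The print package C2 of the K-SEP split of K1: `PSDescendedFrobeniusPrintedInputsAtThree`
# (item stmt-BirchSwinnertonDyer-27549) FROM ITS TWO NAMED FACTS ALONE — Gross–Zagier–Kolyvagin and the
# existence of the descended Frobenius matrix (route `CyclotomicUntwist`, crux K1 `PSRankOneLowerHalfAtThree`)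

Cell `pub/bsd-wall` (D-0145 line `route-BirchSwinnertonDyer-CyclotomicUntwist`, rev 5), seat `bsd-line-cycu-p3` (gen 7).
Helper toward the support item C2 = `PSDescendedFrobeniusPrintedInputsAtThree` (stmt-BirchSwinnertonDyer-27549) of the
K-SEP split of K1 (stmt-21580) / K2 (21581), registered line `dfrob` (cycu-p1 g5), stub `stub_descendedFrobenius`.
THEOREMS ONLY (no definition, no `sorry`); CONDITIONAL results by design (the two hypotheses ARE the item's print
inputs); BSD is not proved by this file and no crux is; the item is NOT closed (its own signature contains the
unproved Gross–Zagier–Kolyvagin fact `PublishedInputGZK`).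

* **`stub_descendedFrobenius_of_exists'`** — the registered text of `stub_descendedFrobenius` / the second conjunct of
  C2 VERBATIM (`∀ W` globally minimal elliptic, `ClassO6 W 3`, `v₃Δ_min` even, `Δ_min/3^v ≡ 1 (mod 3)`:
  `∃ M, W.IsDescendedFrobeniusMatrix M ∧ tr M = ↑(W.psUntwistedTrace) ∧ M 1 0 ≠ 0`) GRANTED ONLY the Literature
  named fact `WeierstrassCurve.isDescendedFrobeniusMatrix_exists` (Berthelot–Ogus (2.4)/(3.14) + Katz 5.1.4/(6.1.1)):
  the reduction map `ρ : ONine →+* ZMod 3` is `NineIntegers.nonempty_residueMap` (cycu-p4 g7, p-landed 11:09Z), the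
  good model with `specialFibreTrace ρ = a_w(W)` for every `ρ` is `exists_nineGoodModel_specialFibreTrace_of_psRow`
  (p627422), the trace is LAW L-a3 (N) and `M₁₀ ≠ 0` is `IsDescendedFrobeniusMatrix.entry_one_zero_ne_zero`;
* **`psDescendedFrobeniusPrintedInputsAtThree_of_print`** — item 27549 BY NAME from
  `(hGZK : rank_eq_analyticRank_of_analyticRank_le_one) (hex : isDescendedFrobeniusMatrix_exists)`: C2 costs
  EXACTLY these two printed facts and nothing else;

References: B. Gross, D. Zagier, Invent. Math. 84 (1986) [GrossZagier1986]; V. Kolyvagin, Progr. Math. 87 (1990)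
[Kolyvagin1990]; P. Berthelot, A. Ogus, Invent. Math. 72 (1983) (2.4), (3.14) [BerthelotOgus1983]; N. M. Katz,
LNM 868 (1981) Thm. 5.1.4, (6.1.1) [Katz1981CrystallineDieudonne].
-/

-- single-conjunct summit: `Summit.BirchSwinnertonDyer.BirchSwinnertonDyer.…` repeats the name by design
set_option linter.dupNamespace false
set_option autoImplicit false

noncomputable section

open Literature.NumberTheory.EllipticCurves.DescendedFrobenius
  Summit.BirchSwinnertonDyer.BirchSwinnertonDyer.Theses.CyclotomicUntwist

namespace Summit.BirchSwinnertonDyer.BirchSwinnertonDyer.Theorems.GNineFrobeniusTrace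

/-- **`stub_descendedFrobenius` of line `dfrob` (= the second conjunct of C2), GRANTED ONLY the existence fact.**
Under the Literature named fact `WeierstrassCurve.isDescendedFrobeniusMatrix_exists`, for every `W/ℚ` elliptic and
globally minimal on a principal-series row (`ClassO6 W 3`, `v₃Δ_min` even, `Δ_min/3^v ≡ 1 (mod 3)`):
`∃ M, W.IsDescendedFrobeniusMatrix M ∧ tr M = ↑(W.psUntwistedTrace) ∧ M 1 0 ≠ 0`. The reduction map is
`NineIntegers.nonempty_residueMap`; the rest is `stub_descendedFrobenius_of_exists` (p627422).
[cite: BerthelotOgus1983, Thm. (2.4) and Prop. (3.14)] [cite: Katz1981CrystallineDieudonne, Thm. 5.1.4 and (6.1.1)] -/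
theorem stub_descendedFrobenius_of_exists' (hex : WeierstrassCurve.isDescendedFrobeniusMatrix_exists) :
    ∀ (W : WeierstrassCurve ℚ) [W.IsElliptic] [W.IsGloballyMinimal],
      Summit.BirchSwinnertonDyer.Rank1Residual.Additive.ClassO6 W 3 →
      Even (padicValInt 3 W.minimalDiscriminantInt) →
      W.minimalDiscriminantInt / 3 ^ padicValInt 3 W.minimalDiscriminantInt % 3 = 1 →
      ∃ M : Matrix (Fin 2) (Fin 2) ℚ_[3], W.IsDescendedFrobeniusMatrix M ∧
        M.trace = ((W.psUntwistedTrace : ℤ) : ℚ_[3]) ∧ M 1 0 ≠ 0 :=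
  stub_descendedFrobenius_of_exists hex (Classical.choice NineIntegers.nonempty_residueMap)

/-- **Item C2 = `PSDescendedFrobeniusPrintedInputsAtThree` (stmt-BirchSwinnertonDyer-27549) from its two printed
facts**: Gross–Zagier–Kolyvagin (`rank_eq_analyticRank_of_analyticRank_le_one`, the content of `PublishedInputGZK`)
and the existence of the descended Frobenius matrix (`isDescendedFrobeniusMatrix_exists`). CONDITIONAL by design:
these two hypotheses are exactly the item's print; everything else is kernel.
[cite: GrossZagier1986, Thm. I.6.3] [cite: Kolyvagin1990, Thm. A] [cite: BerthelotOgus1983, Thm. (2.4) and Prop. (3.14)] -/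
theorem psDescendedFrobeniusPrintedInputsAtThree_of_print
    (hGZK : Literature.NumberTheory.EllipticCurves.rank_eq_analyticRank_of_analyticRank_le_one)
    (hex : WeierstrassCurve.isDescendedFrobeniusMatrix_exists) :
    PSDescendedFrobeniusPrintedInputsAtThree :=
  ⟨hGZK, fun W _ _ hO6 hev hsq ↦ stub_descendedFrobenius_of_exists' hex W hO6 hev hsq⟩

end Summit.BirchSwinnertonDyer.BirchSwinnertonDyer.Theorems.GNineFrobeniusTrace

end
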